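import Summits.Ventures.Crystal3D.Theorems.StickyWulffConstantNoReconstructionGainCertificate
import Summits.Ventures.Crystal3D.Theorems.StickyWulffConstantNoReconstructionGainCubicFrame
import HarnessLib

/-!
# Registry balls always admit the certificate: the antipodal-pair argument with a convex gauge

HONEST FRAMING. Part of the venture `Summits/Ventures/Crystal3D` (cell `crystal3d-full`), helper
`--supports` the crux `NoReconstructionGain` (stmt-Ventures-19144, route
`route-Ventures-StickyWulffConstant`), line `adhesion`; continues `…Certificate` / `…Peeling` /
`…OffLattice` (cf-p2's R26 certificate line).  This file proves the REGISTRY half of R26's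
reduction L5, for every normal and with NO rim exemption:

* `fcc_unit_directions` — two sites of `Λ₀ = fccStacking 1 √(2/3)` at distance `1` differ by one
  of the twelve bond vectors `±u, ±v, ±t, ±(u−v), ±(u−t), ±(v−t)`;
* `registry_noGainPotential` — let `q ∈ X \ P` be a REGISTRY ball (a site of `Λ₀`), let the
  substrate `P` and the film balls `R` that may lie Φ-below or Φ-level with `q` all be sites of
  `Λ₀`, every other film partner of `q` being strictly Φ-above; suppose the order of `Φ` on `R`
  near `q` is the order of a real function `f` that is MIDPOINT-CONVEX at `q`
  (`f q ≤ (f (q+w) + f (q−w))/2`) and that substrate partners have `f < f q`.  Then (T2) holds at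
  `q`.  Proof: the partners `q + w` that are substrate or Φ-below, their antipodes `q − w`, and the
  Φ-level partners occupy pairwise disjoint sets of the twelve bond slots (convexity forbids
  `f(q+w) < f(q)` together with `f(q−w) ≤ f(q)`), so `2·#below + 2·#plug + #level ≤ 12`;
* `noGainPotentialAt_of_registry` — cf-p2's L1 verbatim (registered by name): a film of lattice
  sites strictly above a lattice plug along `ν`, `Φ` ordered like the `ν`-height ⇒ (T2) everywhere.

WHAT THIS IS NOT: anything about off-registry balls (see `…OffRegistry`); rung F-C1 not moved.
-/

noncomputable section

namespace Summit.Ventures.Crystal3D.Theorems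

open Summit.Ventures.Crystal3D Finset
open Literature.MathematicalPhysics.StatisticalMechanics (barlowPos barlowStacking fccStacking
  constHagg haggLabel_const barlowPos_mem orderedContacts contactDeficiency)
open scoped InnerProductSpace

/-- `barlowPos` of the negated triple is the negative (the fcc stacking is a lattice). -/
theorem barlowPos_fcc_neg (k i j : ℤ) :
    barlowPos 1 (Real.sqrt (2 / 3)) constHagg (-k) (-i) (-j) =
      -barlowPos 1 (Real.sqrt (2 / 3)) constHagg k i j := by
  have h := barlowPos_fcc_sub 0 0 0 k i j
  rw [barlowPos_zero_zero_zero, zero_sub] at h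
  simp only [zero_sub] at h
  exact h.symm

/-- **The twelve bond vectors.**  Two sites of `Λ₀` at distance `1` differ by `± w(c)` with `c`
one of the six coordinate triples `(0,1,0), (0,0,1), (1,0,0), (0,1,−1), (−1,1,0), (−1,0,1)`. -/
theorem fcc_unit_directions (q x : EuclideanSpace ℝ (Fin 3))
    (hq : q ∈ fccStacking 1 (Real.sqrt (2 / 3))) (hx : x ∈ fccStacking 1 (Real.sqrt (2 / 3)))
    (hd : dist q x = 1) :
    ∃ c ∈ ([((0 : ℤ), (1 : ℤ), (0 : ℤ)), (0, 0, 1), (1, 0, 0), (0, 1, -1), (-1, 1, 0), (-1, 0, 1)] :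
        List (ℤ × ℤ × ℤ)),
      x = q + barlowPos 1 (Real.sqrt (2 / 3)) constHagg c.1 c.2.1 c.2.2 ∨
      x = q - barlowPos 1 (Real.sqrt (2 / 3)) constHagg c.1 c.2.1 c.2.2 := by
  obtain ⟨kq, iq, jq, rfl⟩ := hq
  obtain ⟨kx, ix, jx, rfl⟩ := hx
  have hsub := barlowPos_fcc_sub kx ix jx kq iq jq
  have hn : ‖barlowPos 1 (Real.sqrt (2 / 3)) constHagg (kx - kq) (ix - iq) (jx - jq)‖ ^ 2 = 1 := by
    rw [← hsub, ← dist_eq_norm, dist_comm, hd, one_pow]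
  rw [norm_sq_barlowPos_fcc] at hn
  have hQ : (ix - iq) ^ 2 + (jx - jq) ^ 2 + (kx - kq) ^ 2 + (ix - iq) * (jx - jq) +
      (ix - iq) * (kx - kq) + (jx - jq) * (kx - kq) = 1 := by exact_mod_cast hn
  -- bound the coordinates and decide
  generalize hi : ix - iq = i at hQ
  generalize hj : jx - jq = j at hQ
  generalize hk : kx - kq = k at hQ
  have h1 : (i + j) ^ 2 ≤ 2 := by nlinarith [sq_nonneg (i + k), sq_nonneg (j + k)]
  have h2 : (i + k) ^ 2 ≤ 2 := by nlinarith [sq_nonneg (i + j), sq_nonneg (j + k)]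
  have h3 : (j + k) ^ 2 ≤ 2 := by nlinarith [sq_nonneg (i + j), sq_nonneg (i + k)]
  have hij : -1 ≤ i + j ∧ i + j ≤ 1 := by constructor <;> nlinarith
  have hik : -1 ≤ i + k ∧ i + k ≤ 1 := by constructor <;> nlinarith
  have hjk : -1 ≤ j + k ∧ j + k ≤ 1 := by constructor <;> nlinarith
  have hib : -1 ≤ i ∧ i ≤ 1 := by omega
  have hjb : -1 ≤ j ∧ j ≤ 1 := by omega
  have hkb : -1 ≤ k ∧ k ≤ 1 := by omega
  have key : ∀ k₁ ∈ Finset.Icc (-1 : ℤ) 1, ∀ i₁ ∈ Finset.Icc (-1 : ℤ) 1, ∀ j₁ ∈ Finset.Icc (-1 : ℤ) 1,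
      i₁ ^ 2 + j₁ ^ 2 + k₁ ^ 2 + i₁ * j₁ + i₁ * k₁ + j₁ * k₁ = 1 →
      (k₁, i₁, j₁) ∈ ([((0 : ℤ), (1 : ℤ), (0 : ℤ)), (0, 0, 1), (1, 0, 0), (0, 1, -1), (-1, 1, 0),
        (-1, 0, 1)] : List (ℤ × ℤ × ℤ)) ∨
      (-k₁, -i₁, -j₁) ∈ ([((0 : ℤ), (1 : ℤ), (0 : ℤ)), (0, 0, 1), (1, 0, 0), (0, 1, -1), (-1, 1, 0),
        (-1, 0, 1)] : List (ℤ × ℤ × ℤ)) := by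
    decide
  have hxq : barlowPos 1 (Real.sqrt (2 / 3)) constHagg kx ix jx =
      barlowPos 1 (Real.sqrt (2 / 3)) constHagg kq iq jq +
        barlowPos 1 (Real.sqrt (2 / 3)) constHagg k i j := by
    rw [← hi, ← hj, ← hk, ← hsub]; abel
  rcases key k (Finset.mem_Icc.2 hkb) i (Finset.mem_Icc.2 hib) j (Finset.mem_Icc.2 hjb) hQ with h | h
  · exact ⟨(k, i, j), h, Or.inl hxq⟩
  · refine ⟨(-k, -i, -j), h, Or.inr ?_⟩
    simp only
    rw [barlowPos_fcc_neg, sub_neg_eq_add, hxq]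

/-- **Registry balls satisfy (T2): the antipodal-pair argument.**  `X` finite (no packing
hypothesis is needed), `P ⊆ X`, `R ⊆ X \ P`, `q ∈ R`; `P` and `R` consist of sites of `Λ₀`; `Φ` an integer potential
and `f` a real function with: film partners of `q` outside `R` are strictly Φ-above `q`; on the
partners of `q` in `R`, `Φ < Φ q ↔ f < f q` and `Φ = Φ q ↔ f = f q`; substrate partners have
`f < f q`; and `f` is midpoint-convex at `q`.  Then (T2) holds at `q` relative to `(X, P, Φ)`. -/
theorem registry_noGainPotential (X P R : Finset (EuclideanSpace ℝ (Fin 3)))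
    (hPX : P ⊆ X) (hR : R ⊆ X \ P)
    (hPΛ : ∀ p ∈ P, p ∈ fccStacking 1 (Real.sqrt (2 / 3)))
    (hRΛ : ∀ x ∈ R, x ∈ fccStacking 1 (Real.sqrt (2 / 3)))
    (q : EuclideanSpace ℝ (Fin 3)) (hq : q ∈ R) (Φ : EuclideanSpace ℝ (Fin 3) → ℤ)
    (f : EuclideanSpace ℝ (Fin 3) → ℝ)
    (habove : ∀ x ∈ (X \ P) \ R, dist q x = 1 → Φ q < Φ x)
    (hlt : ∀ x ∈ R, dist q x = 1 → (Φ x < Φ q ↔ f x < f q))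
    (heq : ∀ x ∈ R, dist q x = 1 → (Φ x = Φ q ↔ f x = f q))
    (hplug : ∀ p ∈ P, dist q p = 1 → f p < f q)
    (hconv : ∀ w : EuclideanSpace ℝ (Fin 3), 2 * f q ≤ f (q + w) + f (q - w)) :
    (((X \ P).filter fun x => dist q x = 1 ∧ Φ x < Φ q).card : ℤ)
        + ((P.filter fun p => dist q p = 1).card : ℤ)
      ≤ (12 - ((X.filter fun x => dist q x = 1).card : ℤ))
        + (((X \ P).filter fun x => dist q x = 1 ∧ Φ q < Φ x).card : ℤ) := by
  classical
  rw [noGainPotential_iff X P hPX Φ q]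
  -- the below / level partners are in `R`, read through `f`
  have hbelow : ((X \ P).filter fun x => dist q x = 1 ∧ Φ x < Φ q) =
      R.filter fun x => dist q x = 1 ∧ f x < f q := by
    ext x
    simp only [mem_filter]
    constructor
    · rintro ⟨hx, hd, hΦ⟩
      have hxR : x ∈ R := by
        by_contra hxR
        exact absurd hΦ (not_lt.2 (habove x (mem_sdiff.2 ⟨hx, hxR⟩) hd).le)
      exact ⟨hxR, hd, (hlt x hxR hd).1 hΦ⟩
    · rintro ⟨hxR, hd, hf⟩
      exact ⟨hR hxR, hd, (hlt x hxR hd).2 hf⟩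
  have hlevel : ((X \ P).filter fun x => dist q x = 1 ∧ Φ x = Φ q) =
      R.filter fun x => dist q x = 1 ∧ f x = f q := by
    ext x
    simp only [mem_filter]
    constructor
    · rintro ⟨hx, hd, hΦ⟩
      have hxR : x ∈ R := by
        by_contra hxR
        exact absurd hΦ (habove x (mem_sdiff.2 ⟨hx, hxR⟩) hd).ne'
      exact ⟨hxR, hd, (heq x hxR hd).1 hΦ⟩
    · rintro ⟨hxR, hd, hf⟩
      exact ⟨hR hxR, hd, (heq x hxR hd).2 hf⟩
  rw [hbelow, hlevel]
  -- the weight-two set `A` (substrate partners and f-below partners) and the level set `L`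
  set A := (P.filter fun p => dist q p = 1) ∪ (R.filter fun x => dist q x = 1 ∧ f x < f q) with hA
  set L := R.filter fun x => dist q x = 1 ∧ f x = f q with hL
  have hPR : Disjoint P R := (disjoint_sdiff (s := P) (t := X)).mono_right hR
  have hAcard : A.card = (P.filter fun p => dist q p = 1).card +
      (R.filter fun x => dist q x = 1 ∧ f x < f q).card := by
    rw [hA, card_union_of_disjoint]
    exact disjoint_filter_filter hPR
  have hAf : ∀ y ∈ A, dist q y = 1 ∧ f y < f q := by
    intro y hy
    rw [hA, mem_union, mem_filter, mem_filter] at hy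
    rcases hy with ⟨hyP, hd⟩ | ⟨_, hd, hf⟩
    · exact ⟨hd, hplug y hyP hd⟩
    · exact ⟨hd, hf⟩
  have hAΛ : ∀ y ∈ A, y ∈ fccStacking 1 (Real.sqrt (2 / 3)) := by
    intro y hy
    rw [hA, mem_union, mem_filter, mem_filter] at hy
    rcases hy with ⟨hyP, _⟩ | ⟨hyR, _⟩
    · exact hPΛ y hyP
    · exact hRΛ y hyR
  have hLf : ∀ y ∈ L, dist q y = 1 ∧ f y = f q := fun y hy => (mem_filter.1 hy).2
  have hLΛ : ∀ y ∈ L, y ∈ fccStacking 1 (Real.sqrt (2 / 3)) := fun y hy => hRΛ y (mem_filter.1 hy).1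
  -- the pair lemma: `q + w ∈ A` excludes `q − w ∈ A ∪ L`
  have pair : ∀ w : EuclideanSpace ℝ (Fin 3), q + w ∈ A → q - w ∉ A ∧ q - w ∉ L := by
    intro w hw
    have h1 := (hAf _ hw).2
    have hc := hconv w
    constructor
    · intro h2; have := (hAf _ h2).2; linarith
    · intro h2; have := (hLf _ h2).2; linarith
  -- the twelve slots
  set S6 : List (ℤ × ℤ × ℤ) := [((0 : ℤ), (1 : ℤ), (0 : ℤ)), (0, 0, 1), (1, 0, 0), (0, 1, -1),
    (-1, 1, 0), (-1, 0, 1)] with hS6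
  set S12 : Finset (ℤ × ℤ × ℤ) := S6.toFinset ∪ (S6.map fun c => (-c.1, -c.2.1, -c.2.2)).toFinset
    with hS12
  have hS12card : S12.card ≤ 12 := by rw [hS12, hS6]; decide
  set pos : ℤ × ℤ × ℤ → EuclideanSpace ℝ (Fin 3) := fun c =>
    barlowPos 1 (Real.sqrt (2 / 3)) constHagg c.1 c.2.1 c.2.2 with hpos
  have hposneg : ∀ c : ℤ × ℤ × ℤ, pos (-c.1, -c.2.1, -c.2.2) = -pos c := fun c => by
    simp only [hpos]; exact barlowPos_fcc_neg _ _ _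
  have hqΛ : q ∈ fccStacking 1 (Real.sqrt (2 / 3)) := hRΛ q hq
  -- every lattice partner sits in a slot of `S12`
  have slot : ∀ y, y ∈ fccStacking 1 (Real.sqrt (2 / 3)) → dist q y = 1 → ∃ c ∈ S12, y = q + pos c := by
    intro y hy hd
    obtain ⟨c, hc, h⟩ := fcc_unit_directions q y hqΛ hy hd
    rcases h with h | h
    · refine ⟨c, ?_, h⟩
      rw [hS12, mem_union, List.mem_toFinset]; exact Or.inl hc
    · refine ⟨(-c.1, -c.2.1, -c.2.2), ?_, by rw [hposneg, ← sub_eq_add_neg]; exact h⟩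
      rw [hS12, mem_union, List.mem_toFinset, List.mem_toFinset, List.mem_map]
      exact Or.inr ⟨c, hc, rfl⟩
  have hnegS12 : ∀ c ∈ S12, (-c.1, -c.2.1, -c.2.2) ∈ S12 := by
    rw [hS12, hS6]; decide
  -- the three index sets
  set IA := S12.filter fun c => q + pos c ∈ A with hIA
  set IA' := S12.filter fun c => q - pos c ∈ A with hIA'
  set IL := S12.filter fun c => q + pos c ∈ L with hIL
  have hcardA : A.card ≤ IA.card := by
    have : A ⊆ IA.image fun c => q + pos c := by
      intro y hy
      obtain ⟨c, hc, rfl⟩ := slot y (hAΛ y hy) (hAf y hy).1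
      exact mem_image.2 ⟨c, mem_filter.2 ⟨hc, hy⟩, rfl⟩
    exact (card_le_card this).trans card_image_le
  have hcardA' : A.card ≤ IA'.card := by
    have : A ⊆ IA'.image fun c => q - pos c := by
      intro y hy
      obtain ⟨c, hc, rfl⟩ := slot y (hAΛ y hy) (hAf y hy).1
      refine mem_image.2 ⟨(-c.1, -c.2.1, -c.2.2), mem_filter.2 ⟨hnegS12 c hc, ?_⟩, ?_⟩
      · rw [hposneg, sub_neg_eq_add]; exact hy
      · rw [hposneg, sub_neg_eq_add]
    exact (card_le_card this).trans card_image_le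
  have hcardL : L.card ≤ IL.card := by
    have : L ⊆ IL.image fun c => q + pos c := by
      intro y hy
      obtain ⟨c, hc, rfl⟩ := slot y (hLΛ y hy) (hLf y hy).1
      exact mem_image.2 ⟨c, mem_filter.2 ⟨hc, hy⟩, rfl⟩
    exact (card_le_card this).trans card_image_le
  -- pairwise disjoint, inside `S12`
  have hd1 : Disjoint IA IA' := by
    rw [hIA, hIA']
    exact disjoint_filter.2 fun c _ h1 h2 => (pair _ h1).1 h2
  have hd2 : Disjoint IA IL := by
    rw [hIA, hIL]
    refine disjoint_filter.2 fun c _ h1 h2 => ?_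
    have := (hAf _ h1).2; have := (hLf _ h2).2; linarith
  have hd3 : Disjoint IA' IL := by
    rw [hIA', hIL]
    refine disjoint_filter.2 fun c _ h1 h2 => ?_
    -- `q − pos c ∈ A` and `q + pos c ∈ L`: apply the pair lemma to `w = −pos c`
    have h := (pair (-pos c) (by rw [← sub_eq_add_neg]; exact h1)).2
    rw [sub_neg_eq_add] at h
    exact h h2
  have hunion : (IA ∪ IA' ∪ IL).card ≤ 12 := by
    refine le_trans (card_le_card ?_) hS12card
    rw [hIA, hIA', hIL]
    exact union_subset (union_subset (filter_subset _ _) (filter_subset _ _)) (filter_subset _ _)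
  rw [card_union_of_disjoint (disjoint_union_left.2 ⟨hd2, hd3⟩), card_union_of_disjoint hd1] at hunion
  zify at hAcard hcardA hcardA' hcardL hunion
  linarith

/-- **L1 (registry lemma; R26 target typed by planner cf-p2, registered by name).**  If every
ball of `X` is a site of the plug's crystal `Λ₀`, the plug lies strictly below the film along `ν`,
and the integer potential `Φ` is ordered like the `ν`-height on the film, then (T2) holds at every
film ball (the height is affine, hence midpoint-convex: `registry_noGainPotential`). -/
theorem noGainPotentialAt_of_registry : ∀ (X P : Finset (EuclideanSpace ℝ (Fin 3)))
    (ν : EuclideanSpace ℝ (Fin 3)), (∀ p ∈ X, ∀ q ∈ X, p ≠ q → 1 ≤ dist p q) → P ⊆ X →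
    (∀ x ∈ X, x ∈ fccStacking 1 (Real.sqrt (2 / 3))) →
    (∀ p ∈ P, ∀ q ∈ X \ P, ⟪p, ν⟫_ℝ < ⟪q, ν⟫_ℝ) →
    ∀ Φ : EuclideanSpace ℝ (Fin 3) → ℤ,
    (∀ x ∈ X \ P, ∀ y ∈ X \ P, (Φ x < Φ y ↔ ⟪x, ν⟫_ℝ < ⟪y, ν⟫_ℝ)) →
    ∀ q ∈ X \ P,
      (((X \ P).filter fun x => dist q x = 1 ∧ Φ x < Φ q).card : ℤ)
          + ((P.filter fun p => dist q p = 1).card : ℤ)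
        ≤ (12 - ((X.filter fun x => dist q x = 1).card : ℤ))
          + (((X \ P).filter fun x => dist q x = 1 ∧ Φ q < Φ x).card : ℤ) := by
  intro X P ν _hX hPX hreg hP Φ hΦ q hq
  refine registry_noGainPotential X P (X \ P) hPX subset_rfl (fun p hp => hreg p (hPX hp))
    (fun x hx => hreg x (sdiff_subset hx)) q hq Φ (fun y => ⟪y, ν⟫_ℝ) ?_ ?_ ?_ ?_ ?_
  · intro x hx; simp at hx
  · intro x hx _; exact hΦ x hx q hq
  · intro x hx _
    have h1 := hΦ x hx q hq
    have h2 := hΦ q hq x hx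
    constructor
    · intro h; exact le_antisymm (not_lt.1 fun h' => (h2.2 h').ne' h) (not_lt.1 fun h' => (h1.2 h').ne h)
    · intro h; exact le_antisymm (not_lt.1 fun h' => (h2.1 h').ne' h) (not_lt.1 fun h' => (h1.1 h').ne h)
  · intro p hp _; exact hP p hp q hq
  · intro w
    rw [inner_add_left, inner_sub_left]; linarith

end Summit.Ventures.Crystal3D.Theorems
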